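import Summits.CriticalPhenomena.CardyFormulaZ2.Theses.CardyComplexCone
import Literature.Probability.LatticeModels.ExplorationWinding

/-!
# `EdgeCoherence` (stmt-CriticalPhenomena-11385), crux line `fixed-radius-equivariant-cut`:
# the typed support stub `InnerRespEquivariant` of `Cruxes/EdgeCoherence/SketchIdeator2.lean` is FALSE as stated

Crux-triage finding (triager 2, round 1).  The sketch defines the rotation of a bond configuration
as `rotConfig β = {e | e.map rotSite ∈ β}`, which is the PRE-image `R⁻¹ β` of `β` under the
quarter-turn `R = rotSite`, while corners are rotated by `R` itself (`rotCorner (v, k) = (R v, k + 1)`,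
matching `cornerUnit (k + 1) = R (cornerUnit k)`).  The stated equivariance
`innerResp ρ (rotConfig β) (rotCorner e) (c + 1) = innerResp ρ β e c` therefore mixes `R⁻¹` on the
boundary condition with `R` on the entry corner and fails for every `β` that is not invariant under
the half-turn `R²`.  Witness (radius `ρ = 0`, so that the inner configuration is the frozen `β` on
every lattice edge and both sides are deterministic): `β = {s((-1,0),(0,0))}`, `e = ((-1,0), 3)`,
`c = 2`.  Right-hand side: the orbit from `e` follows the open edge into the origin and turns left
around it, `e → (0,2) → (0,3) → (0,0) → (0,1) → ((-1,0),0)`, hitting the centre class `2` at time `1`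
with phase `exp(iπ/6) ≠ 0`.  Left-hand side: `rotCorner e = ((0,-1), 0)` and
`rotConfig β = {s((0,1),(0,0))}`, so the target edge `s((0,-1),(0,0))` of the rotated entry corner is
CLOSED, the orbit stays at the vertex `(0,-1)` outside the ball at time `1`, and the inner response
vanishes for every centre class.  Repair (for the planner): `rotConfig β := {e | e.map rotSite⁻¹ ∈ β}`
(the image), with `rotSite⁻¹ x = ![x 1, -x 0]`; with that definition the equivariance holds by the
rotation invariance of the product measure.

The definitions below are VERBATIM copies of the sketch's (`InBall`, `rotSite`, `rotCorner`,
`rotConfig`, `mixCfg`, `InnerHit`, `innerResp`), placed in this file's namespace; the negated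
statement of `not_innerRespEquivariant` is VERBATIM the body of the sketch's `InnerRespEquivariant`
(stated inline rather than as a named `Prop`, so that no stub constant enters the library).
-/

noncomputable section

open scoped BigOperators Topology Classical
open Filter Set MeasureTheory
open Literature.Probability.LatticeModels Literature.Probability.RandomPlanarGeometry
  Literature.Probability.Percolation

namespace Summit.CriticalPhenomena.CardyFormulaZ2.Theorems.EdgeCoherence.Negative.OneCutStub

/-- VERBATIM (SketchIdeator2): the closed lattice ball of radius `ρ` about the origin. [folklore] -/
def InBall (ρ : ℕ) (x : Site 2) : Prop := x 0 ^ 2 + x 1 ^ 2 ≤ (ρ : ℤ) ^ 2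

/-- VERBATIM (SketchIdeator2): rotation by `π/2` about the origin on sites. [folklore] -/
def rotSite (x : Site 2) : Site 2 := ![-(x 1), x 0]

/-- VERBATIM (SketchIdeator2): rotation of a coded corner. [folklore] -/
def rotCorner (e : Site 2 × Fin 4) : Site 2 × Fin 4 := (rotSite e.1, e.2 + 1)

/-- VERBATIM (SketchIdeator2): "rotation" of a bond configuration — in fact the PRE-image under
`rotSite` (the defect certified below). [folklore] -/
def rotConfig (β : BondConfig (Site 2)) : BondConfig (Site 2) := {e | e.map rotSite ∈ β}

/-- VERBATIM (SketchIdeator2): the quenched inner configuration. [folklore] -/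
def mixCfg (ρ : ℕ) (β ω : BondConfig (Site 2)) : BondConfig (Site 2) :=
  {e | (e ∈ ω ∧ ∀ x ∈ e, InBall ρ x) ∨ (e ∈ β ∧ ∃ x ∈ e, ¬ InBall ρ x)}

/-- VERBATIM (SketchIdeator2): the orbit from `e` is at the centre corner `(0, c)` at time `n`,
having stayed in the ball at times `1, …, n`. [folklore] -/
def InnerHit (ρ : ℕ) (β' : BondConfig (Site 2)) (e : Site 2 × Fin 4) (c : Fin 4) (n : ℕ) : Prop :=
  cornerOrbit β' e n = (0, c) ∧ ∀ m, 0 < m → m ≤ n → InBall ρ (cornerOrbit β' e m).1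

/-- VERBATIM (SketchIdeator2): the δ-free inner response tensor. [folklore] -/
def innerResp (ρ : ℕ) (β : BondConfig (Site 2)) (e : Site 2 × Fin 4) (c : Fin 4) : ℂ :=
  ∫ ω, (∑' n : ℕ, if InnerHit ρ (mixCfg ρ β ω) e c n then
      Complex.exp (-(Complex.I / 3) * ((Real.pi / 2 *
        ∑ i ∈ Finset.range n, (turnSign (mixCfg ρ β ω) (cornerOrbit (mixCfg ρ β ω) e i) : ℝ) : ℝ) : ℂ))
      else 0)
    ∂(bondPercolation (zdGraph 2) half)

/-! ## The witness -/

/-- The site `(-1, 0)`. [folklore] -/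
def w : Site 2 := ![-1, 0]

/-- The site `(0, -1)` (`= rotSite w`). [folklore] -/
def s₁ : Site 2 := ![0, -1]

/-- The boundary condition of the witness: only the edge `{(-1,0), (0,0)}` is open. [folklore] -/
def βw : BondConfig (Site 2) := {s(w, (0 : Site 2))}

/-- The entry corner of the witness: `((-1,0), 3)`, whose target edge is `{(-1,0),(0,0)}`. [folklore] -/
def ew : Site 2 × Fin 4 := (w, 3)

/-- The site `(-1,0)` is not the origin. [folklore] -/
lemma w_ne_zero : w ≠ 0 := by
  intro h; have := congrFun h 0; simp [w] at this

/-- The site `(0,-1)` is not the origin. [folklore] -/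
lemma s₁_ne_zero : s₁ ≠ 0 := by
  intro h; have := congrFun h 1; simp [s₁] at this

/-- `(-1,0) ≠ (0,-1)`. [folklore] -/
lemma w_ne_s₁ : w ≠ s₁ := by
  intro h; have := congrFun h 0; simp [w, s₁] at this

/-- `(-1,0)` is outside the ball of radius `0`. [folklore] -/
lemma not_inBall_w : ¬ InBall 0 w := by simp [InBall, w]

/-- `(0,-1)` is outside the ball of radius `0`. [folklore] -/
lemma not_inBall_s₁ : ¬ InBall 0 s₁ := by simp [InBall, s₁]

/-- The origin is in the ball of radius `0`. [folklore] -/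
lemma inBall_zero : InBall 0 (0 : Site 2) := by simp [InBall]

/-- The quarter-turn sends `(-1,0)` to `(0,-1)`. [folklore] -/
lemma rotSite_w : rotSite w = s₁ := by
  ext i; fin_cases i <;> simp [rotSite, w, s₁]

/-- The quarter-turn sends `(0,-1)` to `(1,0)`. [folklore] -/
lemma rotSite_s₁ : rotSite s₁ = ![1, 0] := by
  ext i; fin_cases i <;> simp [rotSite, s₁]

/-- The quarter-turn fixes the origin. [folklore] -/
lemma rotSite_zero : rotSite 0 = 0 := by
  ext i; fin_cases i <;> simp [rotSite]

/-- `(-1,0) + e₀ = 0`. [folklore] -/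
lemma w_add_e₀ : w + cornerUnit 0 = 0 := by
  ext i; fin_cases i <;> simp [w, cornerUnit]

/-- `(0,-1) + e₁ = 0`. [folklore] -/
lemma s₁_add_e₁ : s₁ + cornerUnit 1 = 0 := by
  ext i; fin_cases i <;> simp [s₁, cornerUnit]

/-- `cornerUnit 2 = -e₀ = (-1,0)`. [folklore] -/
lemma cornerUnit_two : cornerUnit 2 = w := by
  ext i; fin_cases i <;> simp [w, cornerUnit]

/-- Membership in `mixCfg 0 β ω` of a pair with an endpoint off the origin is membership in `β`. [folklore] -/
lemma mem_mixCfg_zero_iff {β ω : BondConfig (Site 2)} {a b : Site 2} (ha : ¬ InBall 0 a) :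
    s(a, b) ∈ mixCfg 0 β ω ↔ s(a, b) ∈ β := by
  simp only [mixCfg, Set.mem_setOf_eq, Sym2.mem_iff, forall_eq_or_imp, forall_eq, exists_eq_or_imp,
    exists_eq_left]
  tauto

/-! ### Right-hand side: the orbit from `ew` in the frozen configuration `βw` -/

section RHS

variable (ω : BondConfig (Site 2))

local notation "μw" => mixCfg 0 βw ω

/-- The target edge of the entry corner is `{(-1,0), 0}`. [folklore] -/
lemma cTgt_ew : cTgt ew = s(w, (0 : Site 2)) := by
  simp only [cTgt, ew]
  have : (3 : Fin 4) + 1 = 0 := by decide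
  rw [this, w_add_e₀]

/-- That edge is open in the witness configuration. [folklore] -/
lemma cTgt_ew_mem : cTgt ew ∈ μw := by
  rw [cTgt_ew, mem_mixCfg_zero_iff not_inBall_w]; simp [βw]

/-- A lattice edge at the origin other than `{0, (-1,0)}` is closed in the witness. [folklore] -/
lemma cTgt_origin_not_mem {k : Fin 4} (hk : cornerUnit (k + 1) ≠ w) : cTgt ((0 : Site 2), k) ∉ μw := by
  simp only [cTgt, zero_add]
  rw [Sym2.eq_swap, mem_mixCfg_zero_iff (β := βw) (ω := ω) ?_]
  · simp only [βw, Set.mem_singleton_iff, Sym2.eq_iff]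
    rintro (⟨h, -⟩ | ⟨h1, h2⟩)
    · exact hk h
    · exact w_ne_zero h2.symm
  · -- `cornerUnit (k+1)` is a unit vector, not the origin
    intro h
    simp only [InBall, Nat.cast_zero] at h
    have h0 : cornerUnit (k + 1) = 0 := by
      ext i; fin_cases i <;> simp <;> nlinarith [sq_nonneg (cornerUnit (k + 1) 0), sq_nonneg (cornerUnit (k + 1) 1)]
    have : cornerUnit (k + 1) ≠ 0 := by
      generalize k + 1 = j
      fin_cases j <;> simp [cornerUnit]
    exact this h0

/-- Step 1 of the witness orbit: follow the open edge into the origin, class `2`. [folklore] -/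
lemma orbit_one : cornerOrbit μw ew 1 = ((0 : Site 2), 2) := by
  show nextCorner μw ew = _
  rw [nextCorner_of_mem (cTgt_ew_mem ω)]
  simp only [ew]
  have h1 : (3 : Fin 4) + 1 = 0 := by decide
  have h2 : (3 : Fin 4) + 3 = 2 := by decide
  rw [h1, h2, w_add_e₀]

/-- Step 2: turn left around the origin, class `3`. [folklore] -/
lemma orbit_two : cornerOrbit μw ew 2 = ((0 : Site 2), 3) := by
  show nextCorner μw (cornerOrbit μw ew 1) = _
  rw [orbit_one, nextCorner_of_not_mem (cTgt_origin_not_mem ω ?_)]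
  · rfl
  · decide

/-- Step 3: class `0`. [folklore] -/
lemma orbit_three : cornerOrbit μw ew 3 = ((0 : Site 2), 0) := by
  show nextCorner μw (cornerOrbit μw ew 2) = _
  rw [orbit_two, nextCorner_of_not_mem (cTgt_origin_not_mem ω ?_)]
  · rfl
  · decide

/-- Step 4: class `1`. [folklore] -/
lemma orbit_four : cornerOrbit μw ew 4 = ((0 : Site 2), 1) := by
  show nextCorner μw (cornerOrbit μw ew 3) = _
  rw [orbit_three, nextCorner_of_not_mem (cTgt_origin_not_mem ω ?_)]
  · rfl
  · decide

/-- The target edge of `(0,1)` is the open edge `{0, (-1,0)}`. [folklore] -/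
lemma cTgt_zero_one_mem : cTgt ((0 : Site 2), (1 : Fin 4)) ∈ μw := by
  simp only [cTgt, zero_add]
  have : (1 : Fin 4) + 1 = 2 := by decide
  rw [this, cornerUnit_two, Sym2.eq_swap, mem_mixCfg_zero_iff not_inBall_w]
  simp [βw]

/-- Step 5: the orbit leaves the origin along the open edge. [folklore] -/
lemma orbit_five : cornerOrbit μw ew 5 = (w, 0) := by
  show nextCorner μw (cornerOrbit μw ew 4) = _
  rw [orbit_four, nextCorner_of_mem (cTgt_zero_one_mem ω)]
  have h1 : (1 : Fin 4) + 1 = 2 := by decide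
  have h2 : (1 : Fin 4) + 3 = 0 := by decide
  simp only [h1, h2, cornerUnit_two, zero_add]

/-- In the witness the orbit hits the centre class `2` exactly at time `1`. [folklore] -/
lemma innerHit_rhs_iff (n : ℕ) : InnerHit 0 μw ew 2 n ↔ n = 1 := by
  constructor
  · rintro ⟨hn, hball⟩
    by_contra h1
    rcases Nat.lt_or_ge n 5 with hlt | hge
    · interval_cases n
      · exact w_ne_zero (congrArg Prod.fst hn)
      · exact h1 rfl
      · rw [orbit_two] at hn; simpa using congrArg Prod.snd hn
      · rw [orbit_three] at hn; simpa using congrArg Prod.snd hn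
      · rw [orbit_four] at hn; simpa using congrArg Prod.snd hn
    · have := hball 5 (by norm_num) hge
      rw [orbit_five] at this
      exact not_inBall_w this
  · rintro rfl
    refine ⟨orbit_one ω, fun m hm hm1 => ?_⟩
    obtain rfl : m = 1 := le_antisymm hm1 hm
    rw [orbit_one]; exact inBall_zero

/-- The first turn of the witness orbit is a right turn (`-1`). [folklore] -/
lemma turnSign_ew : turnSign μw ew = -1 := by
  unfold turnSign; rw [if_pos (cTgt_ew_mem ω)]

/-- The right-hand side integrand is the constant `exp(iπ/6)`-type phase. [folklore] -/
lemma rhs_integrand :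
    (∑' n : ℕ, if InnerHit 0 μw ew 2 n then
      Complex.exp (-(Complex.I / 3) * ((Real.pi / 2 *
        ∑ i ∈ Finset.range n, (turnSign μw (cornerOrbit μw ew i) : ℝ) : ℝ) : ℂ))
      else 0) =
    Complex.exp (-(Complex.I / 3) * ((Real.pi / 2 * (-1 : ℝ) : ℝ) : ℂ)) := by
  rw [tsum_eq_single 1]
  · rw [if_pos ((innerHit_rhs_iff ω 1).2 rfl)]
    congr 4
    rw [Finset.sum_range_one]
    show ((turnSign μw (cornerOrbit μw ew 0) : ℤ) : ℝ) = -1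
    rw [show cornerOrbit μw ew 0 = ew from rfl, turnSign_ew]
    norm_num
  · intro n hn
    rw [if_neg]
    rwa [innerHit_rhs_iff]

end RHS

/-! ### Left-hand side: the rotated entry corner faces a CLOSED edge and never enters -/

section LHS

variable (ω : BondConfig (Site 2))

local notation "μr" => mixCfg 0 (rotConfig βw) ω

/-- The rotated entry corner is `((0,-1), 0)`. [folklore] -/
lemma rotCorner_ew : rotCorner ew = (s₁, 0) := by
  simp only [rotCorner, ew, rotSite_w]
  congr 1

/-- Its target edge is `{(0,-1), 0}`. [folklore] -/
lemma cTgt_s₁ : cTgt (s₁, (0 : Fin 4)) = s(s₁, (0 : Site 2)) := by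
  simp only [cTgt]
  have : (0 : Fin 4) + 1 = 1 := by decide
  rw [this, s₁_add_e₁]

/-- That edge is CLOSED in `rotConfig βw = {s((0,1), 0)}` — the defect. [folklore] -/
lemma cTgt_s₁_not_mem : cTgt (s₁, (0 : Fin 4)) ∉ μr := by
  rw [cTgt_s₁, mem_mixCfg_zero_iff not_inBall_s₁]
  simp only [rotConfig, Set.mem_setOf_eq, Sym2.map_mk, rotSite_s₁, rotSite_zero, βw,
    Set.mem_singleton_iff, Sym2.eq_iff]
  rintro (⟨h, -⟩ | ⟨h, -⟩)
  · have := congrFun h 0; simp [w] at this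
  · have := congrFun h 0; simp at this

/-- So the rotated orbit stays at `(0,-1)` at time `1`. [folklore] -/
lemma orbit_lhs_one : cornerOrbit μr (s₁, 0) 1 = (s₁, 1) := by
  show nextCorner μr (s₁, 0) = _
  rw [nextCorner_of_not_mem (cTgt_s₁_not_mem ω)]
  rfl

/-- Hence the rotated orbit never registers an inner hit. [folklore] -/
lemma not_innerHit_lhs (c : Fin 4) (n : ℕ) : ¬ InnerHit 0 μr (s₁, 0) c n := by
  rintro ⟨hn, hball⟩
  rcases Nat.eq_zero_or_pos n with rfl | hpos
  · exact s₁_ne_zero (congrArg Prod.fst hn)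
  · have := hball 1 Nat.one_pos hpos
    rw [orbit_lhs_one] at this
    exact not_inBall_s₁ this

/-- The left-hand side integrand vanishes identically. [folklore] -/
lemma lhs_integrand (c : Fin 4) :
    (∑' n : ℕ, if InnerHit 0 μr (s₁, 0) c n then
      Complex.exp (-(Complex.I / 3) * ((Real.pi / 2 *
        ∑ i ∈ Finset.range n, (turnSign μr (cornerOrbit μr (s₁, 0) i) : ℝ) : ℝ) : ℂ))
      else 0) = 0 := by
  simp only [not_innerHit_lhs ω c, if_false, tsum_zero]

end LHS

/-- **The typed stub `InnerRespEquivariant` of the `fixed-radius-equivariant-cut` sketch is false.**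
Witness `ρ = 0`, `β = {s((-1,0),(0,0))}`, `e = ((-1,0),3)`, `c = 2`: the left-hand side vanishes, the
right-hand side is a unit phase. [folklore] -/
theorem not_innerRespEquivariant :
    ¬ ∀ (ρ : ℕ) (β : BondConfig (Site 2)) (e : Site 2 × Fin 4) (c : Fin 4),
        innerResp ρ (rotConfig β) (rotCorner e) (c + 1) = innerResp ρ β e c := by
  intro h
  have key := h 0 βw ew 2
  have lhs : innerResp 0 (rotConfig βw) (rotCorner ew) (2 + 1) = 0 := by
    rw [rotCorner_ew]
    simp only [innerResp, lhs_integrand, integral_zero]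
  have rhs : innerResp 0 βw ew 2 =
      Complex.exp (-(Complex.I / 3) * ((Real.pi / 2 * (-1 : ℝ) : ℝ) : ℂ)) := by
    simp only [innerResp, rhs_integrand, integral_const, measure_univ, ENNReal.toReal_one,
      one_smul, Measure.real]
  rw [lhs, rhs] at key
  exact Complex.exp_ne_zero _ key.symm

end Summit.CriticalPhenomena.CardyFormulaZ2.Theorems.EdgeCoherence.Negative.OneCutStub

end
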